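/-
Copyright (c) 2026 the pub-hodgecm-mathlib formalisation cell (harness21).  Prover seat hodgecm-mathlib-K2E3-p23 (g9), Track B «K2-LIT» ∕ hLiu418 #184♮,
Road I v3, unit U5 «THE CLOSE», FACE-D₀ row `hfin₂`: THE FINITE LINE-CLASS LETTER `hloc₂` OF THE THETA SIDE AT ONE FINITE PLACE `v` — «a rank-one index carrying
a Fourier coefficient of a doubled line theta lift has its line in the class of the line of the datum» — over the S-letters organ ★ p864061 ∕ p864126 ∕ p864243 ∕
p864330 and the rank-one model head ★ `K2LiuFirstTermLineLiftRankOneRowModelConj`.  THEOREMS ONLY.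
-/
import Summits.HodgeConjecture.HodgeConjecture.Theorems.K2LiuFirstTermLineLiftRankOneRowModelConj   -- this seat (R1): `exists_lineGram_of_fourierCoeffDelta_thetaLift_ne_zero_of_finLineModel_conj`
import Summits.HodgeConjecture.HodgeConjecture.Theorems.K2LiuFirstTermLineLiftRankRowAtPlace        -- K2Liu-p02 ★ p864364: `exists_rho_f_at` (brings ★ p864051 `exists_Tg_pairRep_line_lineCayley_of_fst`, ★ (t), ★ (c))
import Summits.HodgeConjecture.HodgeConjecture.Theorems.K2LiuFinLineModelLettersAtPlaceD           -- this seat (g8) ★ p864330 PART 3: `isLocallyConstant_letter`, `coe_rho_letter` (brings PART 1 ∕ 2a ∕ 2b)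
import Summits.HodgeConjecture.HodgeConjecture.Theorems.K2LiuRankOneOrbitUniformity                -- ★ U2c: `locF_eq_of_eq_mul_conjLocal`
import Mathlib.Topology.ContinuousMap.Algebra                                                       -- `continuousSubmodule`
import HarnessLib

/-!
# K2_Liu road (hLiu418 = stmt-HodgeConjecture-24832), U5 «THE CLOSE», FACE-D₀ row `hfin₂`: THE LINE-CLASS LETTER `hloc₂` OF THE THETA SIDE AT THE PLACE `v`

Cell `pub/hodgecm-mathlib` (D-0151), Track B, build stream 29; helper lane `--supports stmt-HodgeConjecture-24832 --as helper`, count-neutral; closes no socket.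
THEOREMS ONLY (no `def`, no `instance`, no notation, no named-fact hypothesis, no `sorry`).

THE LETTER (FACE-D₀ desk K2Liu-p02 (g9), K2 bus 02:18:17Z, Fourier-coefficient level, `λ` generic).  For the doubled line theta lifts `Θ̃_Φ(fw)` of the line
`⟨a′⟩` (★ D8 `doubledLineThetaLift`), a finite place `v` of `L⁺`, an enumeration `ρ : Fin n ≃ Fin 2`, a unit `b` of `L⁺` and `u : Fin 2 → L` with some `u k = 1`:
if the Fourier coefficient of some `Θ̃_Φ(fw)` at the DICTIONARY INDEX of the rank-one hermitian matrix `β = b • ū ⊗ u` is non-zero at some `h ∈ H(𝔸)`, then the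
lines `⟨b⟩` and the line of the model have the same class at `v` (`locF`, [Liu2021, Def. 4.11–4.12]).
* §1 ring bookkeeping: `map_smul_vecMulVec_conj` (a ring hom through `b • σ(u) ⊗ u`), `reindex_reindex_symm`, `trace_dictIndex_mul` (the trace identity
  `tr(S_v · X) = tr(b(X) · β_v)` behind the character letter `hχ` for `S = δ • T⁻¹ β^{ρ⁻¹}`, `b(X) = δ • X T⁻¹` re-enumerated), `reindex_neg`, `dotProduct_comp_single`.
* §2 the norm bookkeeping of the model scalar: ★ p864330's `κ`-model scalar is `a = ι_v(a′ ∕ (4 δ²))` and **`a′ ∕ (4δ²) = (−a′) · Nm((2δ)⁻¹)`**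
  (`toLocalRing_div_four_imagUnitSq`) — so the CLASS OF THE MODEL'S LINE AT `v` IS THAT OF `⟨−a′⟩` (`locF (a′∕(4δ²)) = locF (−a′)`).
* §3 the heads, over the S-letters organ at `v` (★ p864061 `exists_pairing` ∕ `unipDeltaChar_locToAdelic_eq_adeleAddCharAt_trace`, ★ p864126
  `exists_unipDeltaLoc_dressing_eq`, ★ p864330 `isLocallyConstant_letter` ∕ `coe_rho_letter`, ★ p863351 `exists_hom_coe_eq_unipDeltaChar_locToAdelic`), K2Liu-p02's
  ★ p864364 `exists_rho_f_at` + ★ p864051 `exists_Tg_pairRep_line_lineCayley_of_fst`, ★ (t) `exists_linearLift`, ★ (c) `exists_linear_fourierCoeffDelta`, the rank-one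
  model head ★ R1 and ★ U2c `eq_mul_conj_mul_self_of_smul_vecMulVec_eq` ∕ `locF_eq_of_eq_mul_conjLocal`:
  **`hloc_thetaSide_at_place_neg`** — with the dictionary OF RECORD `dict β = δ • (T⁻¹ · β^{ρ⁻¹})` (★ `K2LiuFirstTermHolCutRows`, ★ p864231, ★ p864461):
  a non-zero coefficient at `dict (b • ū ⊗ u)` forces **`locF b v = locF (−a′) v`**;
  **`hloc_thetaSide_at_place`** — the same letter keyed on the CONJUGATE dictionary `(−δ) • (T⁻¹ · β^{ρ⁻¹}) = dict (−β)`: a non-zero coefficient there forces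
  **`locF b v = locF a′ v`** — the printed label of ★ `K2LiuFirstTermIdentityFaceDefs` :236–:245 ∕ ★ p862803 `hfin_rows_of_local_letters`' binder `hloc₂`.
  (The two readings are one statement: `dict (−β) = −dict β` and `locF (−b) = locF (−a′) ↔ locF b = locF a′`.  Which one the FACE-D₀ rows assembler consumes is the
  desk's choice of coefficient family `coeff β := cf (dict β)` vs `cf (dict (−β))`; the rows `hdet hT₁ hT₂ h2₁ h2₂` are invariant under `β ↦ −β`.)
References: [KudlaRallis1994] §3 (support of Fourier coefficients of theta lifts on represented indices); [Rallis1984] §4; [Kudla1994] §3; [Weil1964] n° 13, n° 41;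
[Shimura1997] §18.1 (18.4); [Liu2021] Def. 4.11–4.12, App. B Prop. B.8; [Scharlau1985HermitianForms] Ch. 10 §1; [CasselsFrohlichANT1967] Ch. II §10, Ch. XV §2.2.
HONEST LABEL: `hfin₂` NOT discharged (the archimedean sign letter `hsign₂` is open by value; the row's reading into ★ p862803's binders is the assembler's); HC_CM is
proved only modulo the 7 printed citations (2 remaining named inputs: hLiu418 = stmt-HodgeConjecture-24832, h413 = stmt-HodgeConjecture-24833) until rung 0 closes;
this file moves no counter.
-/

set_option autoImplicit false
set_option linter.dupNamespace false -- the mandated namespace repeats `HodgeConjecture.HodgeConjecture`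
-- the line-pair carriers elaborate to very large types; elaborate sequentially (as in ★ p863332 ∕ ★ p864364)
set_option Elab.async false

noncomputable section

open NumberField NumberField.mixedEmbedding MeasureTheory IsDedekindDomain
open scoped Matrix ComplexOrder ENNReal TensorProduct SchwartzMap Classical  -- `Classical`: as ★ p863332

namespace Summit.HodgeConjecture.HodgeConjecture.Cruxes.HLiu418.K2LiuFirstTermLineLiftRankOneRowAtPlace

open Literature.NumberTheory.Automorphic Literature.NumberTheory.Automorphic.UnitaryGroup
open Literature.NumberTheory.Automorphic.UnitaryGroup.QuadraticCoordinates
open Literature.NumberTheory.Automorphic.IdeleClassGroup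
open Literature.NumberTheory.Automorphic.Liu2021
open Literature.NumberTheory.Automorphic.Liu2021.Def411WeilCarriers
open Literature.NumberTheory.Automorphic.Liu2021.Def411WeilCarriersDoubling
open Literature.NumberTheory.GelbartRogawski1991 Literature.NumberTheory.GelbartRogawski1991.UnitaryDualPair
open Literature.NumberTheory.GelbartRogawski1991.GRConstruction
open Literature.NumberTheory.GaloisRepresentations
open Literature.NumberTheory.Weil1964
open Literature.RepresentationTheory Literature.RepresentationTheory.Liu2021
open Literature.RepresentationTheory.HeisenbergGroup
open Literature.NumberTheory.K2Lit.DoubledLineTheta Literature.NumberTheory.K2Lit.SiegelDoubled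
open Literature.MeasureTheory.Group
open Summit.HodgeConjecture.HodgeConjecture.Cruxes.HLiu418.K2LiuSiegelUnipotentFourierDefs
open Summit.HodgeConjecture.HodgeConjecture.Cruxes.HLiu418.K2LiuSiegelUnipotentCharacters
open Summit.HodgeConjecture.HodgeConjecture.Cruxes.HLiu418.K2LiuSiegelUnipotentLocalDefs
open Summit.HodgeConjecture.HodgeConjecture.Cruxes.HLiu418.K2LiuUnipotentCoveringWeight
open Summit.HodgeConjecture.HodgeConjecture.Cruxes.HLiu418.K2LiuFirstTermLineLiftRankRow
open Summit.HodgeConjecture.HodgeConjecture.Cruxes.HLiu418.K2LiuFirstTermLineLiftRankRowAtPlace (exists_rho_f_at)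
open Summit.HodgeConjecture.HodgeConjecture.Cruxes.HLiu418.K2LiuFirstTermLineLiftRankRowCayleyFst (exists_Tg_pairRep_line_lineCayley_of_fst)
open Summit.HodgeConjecture.HodgeConjecture.Cruxes.HLiu418.K2LiuFirstTermLineLiftRankOneRowModelConj
  (exists_lineGram_of_fourierCoeffDelta_thetaLift_ne_zero_of_finLineModel_conj)
open Summit.HodgeConjecture.HodgeConjecture.Cruxes.HLiu418.K2LiuDoubledLineThetaLiftLinear (exists_linearLift)
open Summit.HodgeConjecture.HodgeConjecture.Cruxes.HLiu418.K2LiuFourierCoeffDeltaLinear (exists_linear_fourierCoeffDelta)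
open Summit.HodgeConjecture.HodgeConjecture.Cruxes.HLiu418.K2LiuLineThetaFunctionalOfRecord (continuous_thetaFunctional)
open Summit.HodgeConjecture.HodgeConjecture.Cruxes.HLiu418.K2LiuFinLineModelLettersAtPlace
  (map_adeleFst_toBlocks₁₂_blk_locToAdelic exists_pairing exists_coe_adeleAddCharAt_ne_one unipDeltaChar_locToAdelic_eq_adeleAddCharAt_trace
    trace_reindex_mul_reindex)
open Summit.HodgeConjecture.HodgeConjecture.Cruxes.HLiu418.K2LiuFinLineModelLettersAtPlaceB (exists_unipDeltaLoc_dressing_eq)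
open Summit.HodgeConjecture.HodgeConjecture.Cruxes.HLiu418.K2LiuFinLineModelLettersAtPlaceC (map_nonsing_inv_eq map_reindex)
open Summit.HodgeConjecture.HodgeConjecture.Cruxes.HLiu418.K2LiuFinLineModelLettersAtPlaceD (isLocallyConstant_letter coe_rho_letter)
open Summit.HodgeConjecture.HodgeConjecture.Cruxes.HLiu418.K2LiuFirstTermLineLiftRankRowSmallLetters (exists_hom_coe_eq_unipDeltaChar_locToAdelic)
open Summit.HodgeConjecture.HodgeConjecture.Cruxes.HLiu418.K2LiuRankOneLineGram (map_transpose_smul_vecMulVec_conj eq_mul_conj_mul_self_of_smul_vecMulVec_eq)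
open Summit.HodgeConjecture.HodgeConjecture.Cruxes.HLiu418.K2LiuRankOneOrbitUniformity (locF_eq_of_eq_mul_conjLocal)

/-! ## §1 Ring bookkeeping -/

section Generic

variable {A B : Type*} [CommRing A] [CommRing B] (f : A →+* B)

/-- a ring hom intertwining two conjugations pushes through a rank-one Gram matrix: `f(b • τ(u) ⊗ u) = f b • τ′(f ∘ u) ⊗ (f ∘ u)`. [folklore] -/
theorem map_smul_vecMulVec_conj (τ : A → A) (τ' : B → B) (hτ : ∀ x, f (τ x) = τ' (f x)) {ι : Type*} (b : A) (u : ι → A) :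
    (b • Matrix.vecMulVec (τ ∘ u) u).map f = f b • Matrix.vecMulVec (τ' ∘ (⇑f ∘ u)) (⇑f ∘ u) := by
  ext i j
  simp only [Matrix.map_apply, Matrix.smul_apply, Matrix.vecMulVec_apply, Function.comp_apply, smul_eq_mul, map_mul, hτ]

/-- `reindex ρ ρ ∘ reindex ρ⁻¹ ρ⁻¹ = id`. [folklore] -/
theorem reindex_reindex_symm {C : Type*} {ι κ : Type*} (ρ : ι ≃ κ) (M : Matrix κ κ C) :
    Matrix.reindex ρ ρ (Matrix.reindex ρ.symm ρ.symm M) = M := by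
  ext i j
  simp only [Matrix.reindex_apply, Matrix.submatrix_apply, Equiv.symm_symm, Equiv.apply_symm_apply]

/-- re-enumeration commutes with negation. [folklore] -/
theorem reindex_neg {C : Type*} [Neg C] {ι κ : Type*} (ρ : ι ≃ κ) (M : Matrix ι ι C) :
    Matrix.reindex ρ ρ (-M) = -Matrix.reindex ρ ρ M := rfl

/-- **the trace identity behind the character letter `hχ`** for the dictionary index `S = δ • (T⁻¹ · β^{ρ⁻¹})`: pushed to `B` along `f`,
`tr(f(S) · X) = tr(reindex ρ ρ (f δ • (X · f(T)⁻¹)) · f(β))` (`tr` is cyclic; `reindex` is trace-compatible, ★ `trace_reindex_mul_reindex`).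
[cite: Shimura1997, §18.1 (18.4)] -/
theorem trace_dictIndex_mul {ι κ : Type*} [Fintype ι] [Fintype κ] [DecidableEq ι] [DecidableEq κ] (ρ : ι ≃ κ) (δ : A)
    (T : Matrix ι ι A) (hT : IsUnit T.det) (β : Matrix κ κ A) (X : Matrix ι ι B) :
    Matrix.trace ((δ • (T⁻¹ * Matrix.reindex ρ.symm ρ.symm β)).map f * X) =
      Matrix.trace (Matrix.reindex ρ ρ (f δ • (X * (T.map f)⁻¹)) * β.map f) := by
  rw [Matrix.map_smul' f δ _ (map_mul f), Matrix.map_mul, map_nonsing_inv_eq f T hT, map_reindex, Matrix.smul_mul, Matrix.trace_smul,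
    ← reindex_reindex_symm ρ (β.map f), trace_reindex_mul_reindex, reindex_reindex_symm, Matrix.smul_mul, Matrix.trace_smul,
    Matrix.trace_mul_comm ((T.map f)⁻¹ * Matrix.reindex ρ.symm ρ.symm (β.map f)) X, Matrix.mul_assoc]

/-- `(f ∘ u) · e_k = f (u k)`. [folklore] -/
theorem dotProduct_comp_single {ι : Type*} [Fintype ι] [DecidableEq ι] (u : ι → A) (k : ι) :
    (⇑f ∘ u) ⬝ᵥ Pi.single k 1 = f (u k) := by
  rw [dotProduct_single, mul_one, Function.comp_apply]

end Generic

/-! ## §2 The norm bookkeeping of the model scalar: `a′ ∕ (4δ²) = (−a′) · Nm((2δ)⁻¹)` -/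

section Scalar

variable (L : Type) [Field L] [NumberField L] [IsCMField L] (v : HeightOneSpectrum (𝓞 (Fp L)))

/-- **`(2δ)⁻¹ · \overline{(2δ)⁻¹} = −1 ∕ (4 δ²)`** in the CM field `L` (`c δ = −δ`, `δ² = d ∈ L⁺`). [cite: Liu2021, Def. 4.11–4.12] -/
theorem inv_two_mul_imagUnit_mul_conj :
    (2 * imagUnit L)⁻¹ * (IsCMField.complexConj L) ((2 * imagUnit L)⁻¹) = algebraMap (Fp L) L (-(4 * imagUnitSq L)⁻¹) := by
  have h2δ : (2 * imagUnit L) ≠ 0 := mul_ne_zero two_ne_zero (imagUnit_ne_zero L)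
  have h2δ' : (2 * -imagUnit L) ≠ 0 := mul_ne_zero two_ne_zero (neg_ne_zero.2 (imagUnit_ne_zero L))
  rw [map_inv₀, map_mul, map_ofNat, complexConj_imagUnit, map_neg, map_inv₀, map_mul, map_ofNat, ← imagUnit_mul_self, ← mul_inv,
    show (2 * imagUnit L) * (2 * -imagUnit L) = -(4 * (imagUnit L * imagUnit L)) by ring, inv_neg]

/-- **THE MODEL SCALAR IS THE LINE `⟨−a′⟩` UP TO A NORM**: ★ p864330's `κ`-model scalar `a = ι_v(a′ ∕ (4δ²))` equals `ι_v(−a′) · (z · (σ ⊗ 1) z)` with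
`z = (2δ)⁻¹ ⊗ 1 ∈ L ⊗ L⁺_v` — the input shape of ★ U2c `locF_eq_of_eq_mul_conjLocal`. [cite: Liu2021, Def. 4.11–4.12] [cite: CasselsFrohlichANT1967, Ch. II §10] -/
theorem toLocalRing_div_four_imagUnitSq (a' : (Fp L)ˣ) :
    toLocalRing L v (((a' : Fp L) : v.adicCompletion (Fp L)) / (4 * ((imagUnitSq L : Fp L) : v.adicCompletion (Fp L)))) =
      toLocalRing L v (algebraMap (Fp L) (v.adicCompletion (Fp L)) ((-a' : (Fp L)ˣ) : Fp L)) *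
        (algebraMap L (LocalRing L v) (2 * imagUnit L)⁻¹ *
          conjLocal L (IsCMField.complexConj L) v (algebraMap L (LocalRing L v) (2 * imagUnit L)⁻¹)) := by
  have hc : ∀ x : Fp L, ((x : Fp L) : v.adicCompletion (Fp L)) = algebraMap (Fp L) (v.adicCompletion (Fp L)) x := fun _ => rfl
  rw [conjLocal_algebraMap, ← map_mul, inv_two_mul_imagUnit_mul_conj, ← toLocalRing_coe, hc, ← map_mul, hc, hc,
    ← map_ofNat (algebraMap (Fp L) (v.adicCompletion (Fp L))) 4, ← map_mul, ← map_div₀, ← map_mul, Units.val_neg, div_eq_mul_inv, neg_mul_neg]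

end Scalar

/-! ## §3 The heads: the line-class letter of the theta side at the place `v` -/

section Place

variable (L : Type) [Field L] [NumberField L] [IsCMField L]
variable {N n : ℕ} (e : Fin N × Fin 1 ≃ Fin n)
  (dV : Fin N → L) (hdV : ∀ i, IsCMField.complexConj L (dV i) = dV i)
  (dW : Fin 1 → L) (hdW : ∀ i, IsCMField.complexConj L (dW i) = dW i)
  {n'' : ℕ} (e₁ : Fin (n + n) × Fin 1 ≃ Fin n'')
  (hdV0 : ∀ i, dV i ≠ 0) (hdW0 : ∀ i, dW i ≠ 0)
  (lam : IdeleClassGroup L →ₜ* Circle) (hlam : IsConjugateSymplectic L lam) (a' : (Fp L)ˣ)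
  (hρ : HasThetaMajorants fun
      (p : ↥(UnitaryGroup.adelic (Fp L) L (IsCMField.complexConj L) (n + n) (Matrix.diagonal (dD L e dV hdV dW hdW))) ×
        ↥(UnitaryGroup.adelic (Fp L) L (IsCMField.complexConj L) 1 (JW (Fp L) L a')))
      (Φ : piSchwartzBruhat (Fp L) (Fin n'')) =>
        pairRep (Fp L) L (IsCMField.complexConj L) (n + n) 1 e₁ (Matrix.diagonal (dD L e dV hdV dW hdW)) (JW (Fp L) L a')
          (chiSplittingLine L e₁ (dD L e dV hdV dW hdW) (dD_conj L e dV hdV dW hdW) (dD_ne_zero L e dV hdV dW hdW hdV0 hdW0)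
            (toHeckeCharacter L lam) (isUnitary_toHeckeCharacter L lam)
            ((isOscillatorChar_toHeckeCharacter_iff lam).mpr hlam) (TW (Fp L) a')
            (isUnit_det_TW (Fp L) a') (JW (Fp L) L a') (JW_eq (Fp L) L a'))
          p Φ)
  [MeasurableSpace (↥(UnitaryGroup.adelic (Fp L) L (IsCMField.complexConj L) 1 (JW (Fp L) L a')) ⧸
    (UnitaryGroup.toAdelic (Fp L) L (IsCMField.complexConj L) 1 (JW (Fp L) L a')).range)]
  [BorelSpace (↥(UnitaryGroup.adelic (Fp L) L (IsCMField.complexConj L) 1 (JW (Fp L) L a')) ⧸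
    (UnitaryGroup.toAdelic (Fp L) L (IsCMField.complexConj L) 1 (JW (Fp L) L a')).range)]
  (μW : Measure (↥(UnitaryGroup.adelic (Fp L) L (IsCMField.complexConj L) 1 (JW (Fp L) L a')) ⧸
    (UnitaryGroup.toAdelic (Fp L) L (IsCMField.complexConj L) 1 (JW (Fp L) L a')).range)) [IsFiniteMeasure μW]
  (fw : C(↥(UnitaryGroup.adelic (Fp L) L (IsCMField.complexConj L) 1 (JW (Fp L) L a')) ⧸
    (UnitaryGroup.toAdelic (Fp L) L (IsCMField.complexConj L) 1 (JW (Fp L) L a')).range, ℂ))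
  [MeasurableSpace (unipDelta L e dV hdV dW hdW)] [BorelSpace (unipDelta L e dV hdV dW hdW)]
  (νN : Measure (unipDelta L e dV hdV dW hdW)) [νN.IsMulLeftInvariant] [IsFiniteMeasureOnCompacts νN]
  {βw : unipDelta L e dV hdV dW hdW → ℝ≥0∞} (hβ : IsCoveringWeight (unipDeltaRat L e dV hdV dW hdW) βw) (hβtop : ∫⁻ u, βw u ∂νN ≠ ∞)
  {K : Set (unipDelta L e dV hdV dW hdW)} (hK : IsCompact K) (hβK : ∀ u, βw u ≤ K.indicator 1 u)
  -- the place and the enumeration of the rank-`2` index set (the S-letters organ is instantiated AT `v`)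
  (v : HeightOneSpectrum (𝓞 (Fp L))) (ρ : Fin n ≃ Fin 2)

include hβ hβtop hK hβK

set_option maxHeartbeats 1000000 in -- the statement carries the line datum's `pairRep` telescope (default RED, measured on ★ p864364's heads)
/-- **THE LINE-CLASS LETTER OF THE THETA SIDE AT `v`, DICTIONARY OF RECORD: a rank-one index `b • ū ⊗ u` (`u` with a coordinate `1`) carrying a Fourier
coefficient of a doubled line theta lift at the index `dict(b • ū ⊗ u) = δ • (T⁻¹ · (b • ū ⊗ u)^{ρ⁻¹})` has `locF b v = locF (−a′) v`** — the model's line at `v`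
is `⟨a′∕(4δ²)⟩ = ⟨−a′⟩` (§2).  Proof: the S-letters organ at `v` (★ p864061 ∕ p864126 ∕ p864330) with the EXPLICIT local index `βloc = ι_v b • σ(u_v) ⊗ u_v`
(character letter `hχ` by `trace_dictIndex_mul`), K2Liu-p02's `ρf`∕`Tg` (★ p864364 ∕ p864051), ★ (t)∕(c), the rank-one model head ★ R1, then ★ U2c
`eq_mul_conj_mul_self_of_smul_vecMulVec_eq` (contract with `e_k`) and `locF_eq_of_eq_mul_conjLocal`.
[cite: KudlaRallis1994, §3] [cite: Rallis1984, §4] [cite: Kudla1994, §3] [cite: Liu2021, Def. 4.11–4.12; App. B Prop. B.8 p. 104] [cite: Shimura1997, §18.1 (18.4)] -/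
theorem hloc_thetaSide_at_place_neg (b : (Fp L)ˣ) (u : Fin 2 → L) (hu : ∃ k, u k = 1)
    (hne : ∃ (Φ : piSchwartzBruhat (Fp L) (Fin n'')) (h : HA L e dV hdV dW hdW),
      fourierCoeffDelta L e dV hdV dW hdW νN βw
        (imagUnit L • (((gramR L e dV hdV dW hdW).map (algebraMap (Fp L) L))⁻¹ *
          Matrix.reindex ρ.symm ρ.symm (algebraMap (Fp L) L (b : Fp L) • Matrix.vecMulVec (⇑(IsCMField.complexConj L) ∘ u) u)))
        (doubledLineThetaLift L e dV hdV dW hdW e₁ hdV0 hdW0 lam hlam a' hρ μW Φ fw) h ≠ 0) :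
    locF (Fp L) (imagUnitSq L) b v = locF (Fp L) (imagUnitSq L) (-a') v := by
  haveI : Algebra.IsQuadraticExtension (Fp L) L := IsCMField.isQuadraticExtension L
  obtain ⟨Φ, h, hne⟩ := hne
  obtain ⟨k, hk⟩ := hu
  -- ★ (t): the lift as a linear map; ★ (c): the coefficient as a linear map on the class of continuous forms (as ★ p864364 §2)
  obtain ⟨Bl, hBl⟩ := exists_linearLift L e dV hdV dW hdW e₁ hdV0 hdW0 lam hlam a' hρ μW fw
  obtain ⟨cf, hcf⟩ := exists_linear_fourierCoeffDelta L e dV hdV dW hdW νN hβ.measurable hK hβK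
    (continuousSubmodule (HA L e dV hdV dW hdW) ℂ ℂ) fun _ hF => hF
  have hPB : ∀ Ψ : piSchwartzBruhat (Fp L) (Fin n''), Bl Ψ ∈ continuousSubmodule (HA L e dV hdV dW hdW) ℂ ℂ := by
    intro Ψ
    have hBΨ : Bl Ψ = doubledLineThetaLift L e dV hdV dW hdW e₁ hdV0 hdW0 lam hlam a' hρ μW Ψ fw := funext (hBl Ψ)
    change Continuous (Bl Ψ)
    rw [hBΨ]
    exact continuous_thetaFunctional L e dV hdV dW hdW e₁ hdV0 hdW0 lam hlam a' hρ μW fw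
      (LinearMap.id : piSchwartzBruhat (Fp L) (Fin n'') →ₗ[ℂ] piSchwartzBruhat (Fp L) (Fin n''))
      (T₂ := fun Ψ' => doubledLineThetaLift L e dV hdV dW hdW e₁ hdV0 hdW0 lam hlam a' hρ μW Ψ' fw) (fun _ _ => rfl) Ψ
  -- K2Liu-p02's `ρf` at `ι_v` in both spellings, and the global intertwiner `Tg` keyed on `hX`
  obtain ⟨ρf, hρf, hρf'⟩ := exists_rho_f_at L e dV hdV dW hdW e₁ hdV0 hdW0 a' v
  obtain ⟨Tg, hκ⟩ := exists_Tg_pairRep_line_lineCayley_of_fst L e dV hdV dW hdW e₁ hdV0 hdW0 lam hlam a'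
    (fun z : ↥(unipDeltaLoc L e dV hdV dW hdW v) =>
      (⟨locToAdelic L e dV hdV dW hdW v (z : UnitaryGroup.localPi L (IsCMField.complexConj L) (n + n) (hermD L e dV hdV dW hdW) v),
        locToAdelic_mem_unipDelta L e dV hdV dW hdW z.2⟩ : ↥(unipDelta L e dV hdV dW hdW)))
    (fun z => map_adeleFst_toBlocks₁₂_blk_locToAdelic L e dV hdV dW hdW v _) ρf hρf
  -- the S-letters organ at `v`: pairing, character, dressing
  obtain ⟨π, hπτ, hπ, hπc⟩ := exists_pairing L v
  obtain ⟨χ, hχS⟩ := exists_hom_coe_eq_unipDeltaChar_locToAdelic L e dV hdV dW hdW v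
    (imagUnit L • (((gramR L e dV hdV dW hdW).map (algebraMap (Fp L) L))⁻¹ *
      Matrix.reindex ρ.symm ρ.symm (algebraMap (Fp L) L (b : Fp L) • Matrix.vecMulVec (⇑(IsCMField.complexConj L) ∘ u) u)))
  have hσ : ∀ t : LocalRing L v, conjLocal L (IsCMField.complexConj L) v (conjLocal L (IsCMField.complexConj L) v t) = t :=
    conjLocal_conjLocal_cm L v
  have hTu : IsUnit ((gramR L e dV hdV dW hdW).map (algebraMap (Fp L) L)).det := by
    rw [← RingHom.mapMatrix_apply, ← RingHom.map_det]
    exact (isUnit_det_gram (Fp L) e (isUnit_det_realDiagonal L dV hdV hdV0) (isUnit_det_realDiagonal L dW hdW hdW0)).map _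
  -- the EXPLICIT local index `βloc = ι_v b • σ(u_v) ⊗ u_v` and its Gram presentation over `L`
  have hβmap : (algebraMap (Fp L) L (b : Fp L) • Matrix.vecMulVec (⇑(IsCMField.complexConj L) ∘ u) u).map (algebraMap L (LocalRing L v)) =
      toLocalRing L v (algebraMap (Fp L) (v.adicCompletion (Fp L)) (b : Fp L)) •
        Matrix.vecMulVec (⇑(conjLocal L (IsCMField.complexConj L) v) ∘ (⇑(algebraMap L (LocalRing L v)) ∘ u)) (⇑(algebraMap L (LocalRing L v)) ∘ u) := by
    rw [map_smul_vecMulVec_conj (algebraMap L (LocalRing L v)) (IsCMField.complexConj L) (conjLocal L (IsCMField.complexConj L) v)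
      (fun x => (conjLocal_algebraMap (IsCMField.complexConj L) v x).symm), ← toLocalRing_coe]
    rfl
  have hbσ : conjLocal L (IsCMField.complexConj L) v (toLocalRing L v (algebraMap (Fp L) (v.adicCompletion (Fp L)) (b : Fp L))) =
      toLocalRing L v (algebraMap (Fp L) (v.adicCompletion (Fp L)) (b : Fp L)) := conjLocal_toLocalRing _ v _
  have hherm := map_transpose_smul_vecMulVec_conj (conjLocal L (IsCMField.complexConj L) v) hσ hbσ (⇑(algebraMap L (LocalRing L v)) ∘ u)
  -- the character letter `hχ`: `ψ_S(ι_v z) = ψ_v(Tr tr(b z · βloc))`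
  have hχ : ∀ z : ↥(unipDeltaLoc L e dV hdV dW hdW v), ((χ z : ℂˣ) : ℂ) =
      ((adeleAddCharAt (Fp L) v (π (Matrix.reindex ρ ρ ((algebraMap L (LocalRing L v) (imagUnit L)) •
        ((((blk L e dV hdV dW hdW (locToAdelic L e dV hdV dW hdW v
            (z : UnitaryGroup.localPi L (IsCMField.complexConj L) (n + n) (hermD L e dV hdV dW hdW) v))).toBlocks₁₂).map
            (fun t : AdeleRing (𝓞 L) L => finiteAdeleToLocal L v t.2)) * (((gramR L e dV hdV dW hdW).map (algebraMap (Fp L) L)).map (algebraMap L (LocalRing L v)))⁻¹)))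
        (toLocalRing L v (algebraMap (Fp L) (v.adicCompletion (Fp L)) (b : Fp L)) •
          Matrix.vecMulVec (⇑(conjLocal L (IsCMField.complexConj L) v) ∘ (⇑(algebraMap L (LocalRing L v)) ∘ u)) (⇑(algebraMap L (LocalRing L v)) ∘ u))) :
        Circle) : ℂ) := by
    intro z
    rw [hχS, unipDeltaChar_locToAdelic_eq_adeleAddCharAt_trace, hπτ, ← hβmap,
      trace_dictIndex_mul (algebraMap L (LocalRing L v)) ρ (imagUnit L) _ hTu]
  -- ★ R1: the surviving index is a Gram matrix of the line model at `v`
  obtain ⟨x, hx⟩ := exists_lineGram_of_fourierCoeffDelta_thetaLift_ne_zero_of_finLineModel_conj L e dV hdV dW hdW e₁ hdV0 hdW0 lam hlam a' hρ μW fw νN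
    hβ hβtop _ Bl hBl (continuousSubmodule (HA L e dV hdV dW hdW) ℂ ℂ) hPB (cf _) (hcf _)
    (conjLocal L (IsCMField.complexConj L) v) hσ (fun c => conjLocal_toLocalRing (IsCMField.complexConj L) v c) π hπ
    (adeleAddCharAt (Fp L) v) (exists_coe_adeleAddCharAt_ne_one L v) ρf _
    (fun s hs => exists_unipDeltaLoc_dressing_eq L e dV hdV dW hdW v hdV0 hdW0 ρ s hs) _ (conjLocal_toLocalRing (IsCMField.complexConj L) v _) _
    (fun z => isLocallyConstant_letter L e dV hdV dW hdW v ρ e₁ a' π hπc z)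
    (fun z φ => coe_rho_letter L e dV hdV dW hdW v hdV0 hdW0 ρ e₁ a' π hπτ ρf hρf' z φ) _ hherm χ hχ
    (fun z : ↥(unipDeltaLoc L e dV hdV dW hdW v) =>
      (⟨locToAdelic L e dV hdV dW hdW v (z : UnitaryGroup.localPi L (IsCMField.complexConj L) (n + n) (hermD L e dV hdV dW hdW) v),
        locToAdelic_mem_unipDelta L e dV hdV dW hdW z.2⟩ : ↥(unipDelta L e dV hdV dW hdW)))
    hχS Tg hκ Φ h hne
  -- read the class: contract with `e_k` (`u_v · e_k = 1`), then the model scalar is `ι_v(−a′)` up to the norm of `(2δ)⁻¹`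
  have hc : (⇑(algebraMap L (LocalRing L v)) ∘ u) ⬝ᵥ Pi.single k 1 = 1 := by
    rw [dotProduct_comp_single, hk, map_one]
  have hB := eq_mul_conj_mul_self_of_smul_vecMulVec_eq (conjLocal L (IsCMField.complexConj L) v) hx (Pi.single k 1) hc
  rw [toLocalRing_div_four_imagUnitSq L v a'] at hB
  obtain ⟨t, ht⟩ : ∃ t : LocalRing L v, toLocalRing L v (algebraMap (Fp L) (v.adicCompletion (Fp L)) (b : Fp L)) =
      toLocalRing L v (algebraMap (Fp L) (v.adicCompletion (Fp L)) ((-a' : (Fp L)ˣ) : Fp L)) *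
        (algebraMap L (LocalRing L v) (2 * imagUnit L)⁻¹ * conjLocal L (IsCMField.complexConj L) v (algebraMap L (LocalRing L v) (2 * imagUnit L)⁻¹)) *
        (conjLocal L (IsCMField.complexConj L) v t * t) := ⟨_, hB⟩
  refine locF_eq_of_eq_mul_conjLocal L (-a') b v (algebraMap L (LocalRing L v) (2 * imagUnit L)⁻¹ * t) ?_
  rw [ht, map_mul]
  ring

set_option maxHeartbeats 1000000 in -- idem
/-- **THE LINE-CLASS LETTER `hloc₂` WITH THE PRINTED LABEL `a′`, CONJUGATE DICTIONARY**: a rank-one index `b • ū ⊗ u` carrying a Fourier coefficient of a doubled line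
theta lift at the index `(−δ) • (T⁻¹ · (b • ū ⊗ u)^{ρ⁻¹}) = dict(−(b • ū ⊗ u))` has **`locF b v = locF a′ v`** — `hloc_thetaSide_at_place_neg` at `−b`, and
`locF (−b) = locF (−a′) ↔ locF b = locF a′` (`locF` is a homomorphism).  This is ★ p862803's binder `hloc₂` ∕ ★ FaceDefs :241–:245 for the coefficient family
`coeff β := cf (dict (−β))`. [cite: KudlaRallis1994, §3] [cite: Liu2021, Def. 4.11–4.12; App. B Prop. B.8 p. 104] [cite: Scharlau1985HermitianForms, Ch. 10 §1] -/
theorem hloc_thetaSide_at_place (b : (Fp L)ˣ) (u : Fin 2 → L) (hu : ∃ k, u k = 1)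
    (hne : ∃ (Φ : piSchwartzBruhat (Fp L) (Fin n'')) (h : HA L e dV hdV dW hdW),
      fourierCoeffDelta L e dV hdV dW hdW νN βw
        ((-imagUnit L) • (((gramR L e dV hdV dW hdW).map (algebraMap (Fp L) L))⁻¹ *
          Matrix.reindex ρ.symm ρ.symm (algebraMap (Fp L) L (b : Fp L) • Matrix.vecMulVec (⇑(IsCMField.complexConj L) ∘ u) u)))
        (doubledLineThetaLift L e dV hdV dW hdW e₁ hdV0 hdW0 lam hlam a' hρ μW Φ fw) h ≠ 0) :
    locF (Fp L) (imagUnitSq L) b v = locF (Fp L) (imagUnitSq L) a' v := by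
  have hidx : (-imagUnit L) • (((gramR L e dV hdV dW hdW).map (algebraMap (Fp L) L))⁻¹ *
        Matrix.reindex ρ.symm ρ.symm (algebraMap (Fp L) L (b : Fp L) • Matrix.vecMulVec (⇑(IsCMField.complexConj L) ∘ u) u)) =
      imagUnit L • (((gramR L e dV hdV dW hdW).map (algebraMap (Fp L) L))⁻¹ *
        Matrix.reindex ρ.symm ρ.symm (algebraMap (Fp L) L ((-b : (Fp L)ˣ) : Fp L) • Matrix.vecMulVec (⇑(IsCMField.complexConj L) ∘ u) u)) := by
    rw [Units.val_neg, map_neg, neg_smul, neg_smul, reindex_neg, Matrix.mul_neg, smul_neg]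
  have h := hloc_thetaSide_at_place_neg L e dV hdV dW hdW e₁ hdV0 hdW0 lam hlam a' hρ μW fw νN hβ hβtop hK hβK v ρ (-b) u hu (hidx ▸ hne)
  have hmul : ∀ c : (Fp L)ˣ, locF (Fp L) (imagUnitSq L) (-c) v = locF (Fp L) (imagUnitSq L) (-1) v * locF (Fp L) (imagUnitSq L) c v := by
    intro c
    rw [← neg_one_mul c, map_mul, Pi.mul_apply]
  rw [hmul b, hmul a'] at h
  calc locF (Fp L) (imagUnitSq L) b v
      = (locF (Fp L) (imagUnitSq L) (-1) v)⁻¹ * (locF (Fp L) (imagUnitSq L) (-1) v * locF (Fp L) (imagUnitSq L) b v) :=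
        (inv_mul_cancel_left _ _).symm
    _ = (locF (Fp L) (imagUnitSq L) (-1) v)⁻¹ * (locF (Fp L) (imagUnitSq L) (-1) v * locF (Fp L) (imagUnitSq L) a' v) := by rw [h]
    _ = locF (Fp L) (imagUnitSq L) a' v := inv_mul_cancel_left _ _

end Place

end Summit.HodgeConjecture.HodgeConjecture.Cruxes.HLiu418.K2LiuFirstTermLineLiftRankOneRowAtPlace

end
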